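import Literature.Claims.NS.Chadwick2023
import Literature.Analysis.FluidPDE.WholeSpaceIBP
import Summits.NavierStokesRegularity.NavierStokesRegularity.Theorems.PlanarFluxAPriori.Negative.SlabApexBoundApexFoamField
import Mathlib.Analysis.ODE.ExistUnique
import HarnessLib

/-!
# C34 `Chadwick2023` — NEGATIVE LEMMA MODULO H: display (47) (`Step_3`) is false as soon as ONE datum of the
# ansatz class has a short-time solution in the class (cell `ns-claims`, D-0090; records-grade companion,
# chair ruling «UG CONFIRMED C34» 2026-08-27T04:52:24Z; builder ns-claims-salvage-p2 g3, spec refuter-1 g2)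

Row C34 is ADJUDICATED #59 «unfilled gap (rigidity-certified)» at `Literature.Claims.NS.Chadwick2023.Step_3`
= display (47) pp.22–23: the skeleton PROVES `step3_rigid` / `step3R2_rigid` (ONE universal constant in (47)
forces the velocity to be CONSTANT along every Lagrangian path of every solution of the ansatz class), and the
UG-AUDIT (refuter-1 g2, 04:51:44Z) sharpened the kernel bottleneck to ONE missing fact: short-time existence IN
THE CLASS (classical on a slab, stokeslet decay `(1+|x|)^{3+n}|Dⁿu(t)|` bounded at every slab time) from one
explicit datum. This file proves the reduction in the kernel:

* `v₀` — the explicit datum: the tree's compactly supported solenoidal field `curl(χΨ₀)` (`ApexFoam.vfield 0`,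
  equal to the shear `(x₂, 0, 0)` on `B(0,2)`); `isDatum_v₀` — it is a datum of Theorem 1's class.
* `Step_3_false_of_classSolution` — HYPOTHESES FORM: no solution of the ansatz class on a slab `[0,T]` has a
  compactly supported initial slice with non-zero dissipation `Σᵢ∫|∂ᵢu(0)|² > 0`, if `Step_3` holds;
* `Step_3_false_of_H` — **H(v₀) → ¬ Step_3** with H(v₀) displayed INLINE as the hypothesis (for SOME `ν > 0`
  and SOME `T > 0` there is a solution `(u, p)` of the ansatz class `IsSolutionOn (Icc 0 T) ν` with `u 0 = v₀`:
  weighted short-time classical existence for one Schwartz-class datum; in print: Kukavica–Torres 2006/07,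
  Miyakawa 2000, Brandolese 2004 — not in the tree; a named `def` would be relocated by the gate);
  `dissipation_v₀_pos`: `∂₂v₀(0) = e₀ ≠ 0`.

Route (refuter-1 g2's): given the class solution, Picard–Lindelöf (Mathlib `IsPicardLindelof`, with the
Lipschitz/sup bounds of the jointly smooth `u` on `[0,T] × B̄(x,1)`) gives a Lagrangian path `X` from every `x`
on a short `[0,ε]`; `step3R2_rigid` on every sub-slab `[0,t]` makes `t ↦ u(t, X t)` constant, so its one-sided
derivative at `0` — which by the chain rule is the material derivative `∂ₜu + (u·∇)u` at `(0,x)` — vanishes;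
the momentum equation then reads `∇p(0,·) = νΔv₀` on `ℝ³`. Pairing with the compactly supported
divergence-free `v₀` itself: `∫⟪∇p(0), v₀⟫ = −∫ p(0) div v₀ = 0` (tree `integral_inner_gradient_eq_neg_…`),
while `ν∫⟪Δv₀, v₀⟫ = −ν Σᵢ∫|∂ᵢv₀|² < 0` (tree Green identity `integral_inner_laplacian_add_eq_zero`; `∂₂v₀(0) =
e₀ ≠ 0`). NOT a class change for the row (the locator and the token «unfilled gap» stand); H is NOT constructed
here.

WHAT THIS IS NOT: not a claim about NS regularity or blow-up; not a claim about any author beyond the typed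
locator.
-/

noncomputable section

open Set Function Filter MeasureTheory Metric
open scoped Topology InnerProductSpace RealInnerProductSpace ContDiff NNReal Laplacian

-- lint debt (cell convention): the Theorems namespace repeats `NavierStokesRegularity`.
set_option linter.dupNamespace false

namespace Summit.NavierStokesRegularity.NavierStokesRegularity.Theorems.Chadwick2023

open Literature.Claims.NS.Chadwick2023 Literature.Analysis.FluidPDE
open Summit.NavierStokesRegularity.NavierStokesRegularity.Theorems.PlanarFluxAPriori.Negative

/-! ### The witness datum -/

/-- The explicit datum `v₀ = curl(χΨ₀)` with zero profile: compactly supported, smooth, divergence free, and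
equal to the shear `(x₂, 0, 0)` on the ball `B(0,2)`. -/
def v₀ : (EuclideanSpace ℝ (Fin 3)) → (EuclideanSpace ℝ (Fin 3)) := ApexFoam.vfield fun _ => (0 : ℝ)

/-- `v₀` is smooth. -/
theorem contDiff_v₀ : ContDiff ℝ ∞ v₀ := ApexFoam.contDiff_vfield contDiff_const

/-- `v₀` has compact support. -/
theorem hasCompactSupport_v₀ : HasCompactSupport v₀ := ApexFoam.hasCompactSupport_vfield

/-- `v₀` is divergence free. -/
theorem isDivFree_v₀ : VectorCalculus.IsDivFree v₀ := ApexFoam.isDivFree_vfield contDiff_const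

/-- `v₀` is a datum of Theorem 1's class (smooth, divergence free, stokeslet decay of all derivatives —
indeed compactly supported). -/
theorem isDatum_v₀ : IsDatum v₀ := by
  refine ⟨contDiff_v₀, isDivFree_v₀, fun n => ?_⟩
  obtain ⟨C, hC⟩ := ApexFoam.hasRapidSpatialDecay_vfield (g := fun _ => (0 : ℝ)) contDiff_const n (3 + n)
  exact ⟨C, hC⟩

/-- Near the origin `v₀` is the shear `x ↦ x₂ e₀`. -/
theorem v₀_eventuallyEq : v₀ =ᶠ[𝓝 (0 : (EuclideanSpace ℝ (Fin 3)))]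
    fun x => ((EuclideanSpace.proj (𝕜 := ℝ) (2 : Fin 3)).smulRight (ApexFoam.e 0)) x := by
  have h := ApexFoam.vfield_eventuallyEq (g := fun _ => (0 : ℝ)) contDiff_const
    (x := (0 : (EuclideanSpace ℝ (Fin 3)))) (by simp)
  refine h.trans (Eventually.of_forall fun x => ?_)
  simp [ApexFoam.V₀]

/-- `∂₂v₀(0) = e₀`. -/
theorem fderiv_v₀_zero_apply :
    fderiv ℝ v₀ 0 (EuclideanSpace.single (2 : Fin 3) (1 : ℝ)) = ApexFoam.e 0 := by
  rw [v₀_eventuallyEq.fderiv_eq, ContinuousLinearMap.fderiv]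
  simp

/-- The dissipation of `v₀` is positive: `Σᵢ ∫ |∂ᵢv₀|² > 0`. -/
theorem dissipation_v₀_pos :
    0 < ∑ i, ∫ x, ⟪fderiv ℝ v₀ x (EuclideanSpace.basisFun (Fin 3) ℝ i),
      fderiv ℝ v₀ x (EuclideanSpace.basisFun (Fin 3) ℝ i)⟫_ℝ := by
  have hcont : ∀ i, Continuous fun x => ⟪fderiv ℝ v₀ x (EuclideanSpace.basisFun (Fin 3) ℝ i),
      fderiv ℝ v₀ x (EuclideanSpace.basisFun (Fin 3) ℝ i)⟫_ℝ := fun i =>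
    ((contDiff_v₀.continuous_fderiv (by simp)).clm_apply continuous_const).inner
      ((contDiff_v₀.continuous_fderiv (by simp)).clm_apply continuous_const)
  have hnn : ∀ i x, 0 ≤ ⟪fderiv ℝ v₀ x (EuclideanSpace.basisFun (Fin 3) ℝ i),
      fderiv ℝ v₀ x (EuclideanSpace.basisFun (Fin 3) ℝ i)⟫_ℝ := fun i x => real_inner_self_nonneg
  have hsupp : ∀ i, HasCompactSupport fun x => ⟪fderiv ℝ v₀ x (EuclideanSpace.basisFun (Fin 3) ℝ i),
      fderiv ℝ v₀ x (EuclideanSpace.basisFun (Fin 3) ℝ i)⟫_ℝ := fun i => by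
    refine (hasCompactSupport_v₀.fderiv (𝕜 := ℝ)).mono fun x hx => ?_
    contrapose! hx
    simp only [Function.mem_support, not_not] at hx
    simp [hx]
  have h2 : 0 < ∫ x, ⟪fderiv ℝ v₀ x (EuclideanSpace.basisFun (Fin 3) ℝ 2),
      fderiv ℝ v₀ x (EuclideanSpace.basisFun (Fin 3) ℝ 2)⟫_ℝ := by
    rw [integral_pos_iff_support_of_nonneg (hnn 2) ((hcont 2).integrable_of_hasCompactSupport (hsupp 2))]
    refine ((hcont 2).isOpen_support).measure_pos volume ⟨0, ?_⟩
    rw [Function.mem_support, real_inner_self_eq_norm_sq]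
    have hb : EuclideanSpace.basisFun (Fin 3) ℝ 2 = EuclideanSpace.single (2 : Fin 3) (1 : ℝ) := by simp
    rw [hb, fderiv_v₀_zero_apply]
    simp [ApexFoam.e]
  calc (0 : ℝ) < ∫ x, ⟪fderiv ℝ v₀ x (EuclideanSpace.basisFun (Fin 3) ℝ 2),
      fderiv ℝ v₀ x (EuclideanSpace.basisFun (Fin 3) ℝ 2)⟫_ℝ := h2
    _ ≤ ∑ i, ∫ x, ⟪fderiv ℝ v₀ x (EuclideanSpace.basisFun (Fin 3) ℝ i),
        fderiv ℝ v₀ x (EuclideanSpace.basisFun (Fin 3) ℝ i)⟫_ℝ :=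
      Finset.single_le_sum (f := fun i => ∫ x, ⟪fderiv ℝ v₀ x (EuclideanSpace.basisFun (Fin 3) ℝ i),
        fderiv ℝ v₀ x (EuclideanSpace.basisFun (Fin 3) ℝ i)⟫_ℝ) (fun i _ => integral_nonneg (hnn i))
        (Finset.mem_univ (2 : Fin 3))

/-! ### Lagrangian paths of a classical solution (Picard–Lindelöf on a short interval) -/

/-- A jointly smooth field on `[0,T] × ℝ³` admits, from every point, a Lagrangian path on some `[0,ε]`,
`0 < ε ≤ T` (Picard–Lindelöf with the Lipschitz and sup bounds of `u` on the compact `[0,T] × B̄(x,1)`). -/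
theorem exists_trajectory {T : ℝ} (hT : 0 < T) {u : ℝ → (EuclideanSpace ℝ (Fin 3)) → (EuclideanSpace ℝ (Fin 3))}
    (hu : IsSmoothSpaceTimeOn (Icc 0 T) u) (x : (EuclideanSpace ℝ (Fin 3))) :
    ∃ ε : ℝ, 0 < ε ∧ ε ≤ T ∧ ∃ X : ℝ → (EuclideanSpace ℝ (Fin 3)), X 0 = x ∧ IsTrajectoryOn u (Icc 0 ε) X := by
  -- the compact convex box `C = [0,T] × B̄(x,1)` and the uncurried field on it
  set F : ℝ × (EuclideanSpace ℝ (Fin 3)) → (EuclideanSpace ℝ (Fin 3)) := uncurry u with hF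
  set C : Set (ℝ × (EuclideanSpace ℝ (Fin 3))) := Icc 0 T ×ˢ closedBall x 1 with hC
  have hCsub : C ⊆ Icc 0 T ×ˢ univ := prod_mono Subset.rfl (subset_univ _)
  have hFC : ContDiffOn ℝ ∞ F C := (show ContDiffOn ℝ ∞ F (Icc 0 T ×ˢ univ) from hu).mono hCsub
  have hCc : IsCompact C := isCompact_Icc.prod (isCompact_closedBall x 1)
  have hCconv : Convex ℝ C := (convex_Icc 0 T).prod (convex_closedBall x 1)
  have hCud : UniqueDiffOn ℝ C :=
    (uniqueDiffOn_Icc hT).prod (uniqueDiffOn_convex (convex_closedBall x 1)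
      (by rw [interior_closedBall x one_ne_zero]; exact ⟨x, mem_ball_self one_pos⟩))
  -- sup bound
  obtain ⟨L₀, hL₀⟩ := hCc.exists_bound_of_continuousOn hFC.continuousOn
  -- Lipschitz bound from the bounded derivative
  obtain ⟨K₀, hK₀⟩ := hCc.exists_bound_of_continuousOn (hFC.continuousOn_fderivWithin hCud (by simp))
  set Lr : ℝ := max L₀ 0 + 1 with hLr
  have hLr0 : 0 < Lr := by rw [hLr]; positivity
  set L : ℝ≥0 := Lr.toNNReal with hLdef
  have hLcoe : (L : ℝ) = Lr := Real.coe_toNNReal _ hLr0.le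
  set K : ℝ≥0 := (max K₀ 0).toNNReal with hKdef
  have hKcoe : (K : ℝ) = max K₀ 0 := Real.coe_toNNReal _ (le_max_right _ _)
  have hLip : LipschitzOnWith K F C :=
    hCconv.lipschitzOnWith_of_nnnorm_fderivWithin_le (𝕜 := ℝ) (hFC.differentiableOn (by simp))
      fun z hz => by
        rw [← NNReal.coe_le_coe, coe_nnnorm, hKcoe]
        exact (hK₀ z hz).trans (le_max_left _ _)
  -- the time horizon of the Picard–Lindelöf box
  set ε : ℝ := min T (1 / Lr) with hεdef
  have hε0 : 0 < ε := lt_min hT (by positivity)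
  have hεT : ε ≤ T := min_le_left _ _
  have hεL : Lr * ε ≤ 1 := by
    have h1 : ε ≤ 1 / Lr := min_le_right _ _
    calc Lr * ε ≤ Lr * (1 / Lr) := mul_le_mul_of_nonneg_left h1 hLr0.le
      _ = 1 := by field_simp
  have hsubT : Icc 0 ε ⊆ Icc 0 T := Icc_subset_Icc_right hεT
  let t₀ : Icc (0 : ℝ) ε := ⟨0, left_mem_Icc.2 hε0.le⟩
  have hPL : IsPicardLindelof u t₀ x 1 0 L K := by
    refine ⟨fun t ht => ?_, fun y hy => ?_, fun t ht y hy => ?_, ?_⟩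
    · -- Lipschitz in space at fixed time
      refine LipschitzOnWith.of_dist_le_mul fun y hy y' hy' => ?_
      have h := hLip.dist_le_mul (t, y) ⟨hsubT ht, hy⟩ (t, y') ⟨hsubT ht, hy'⟩
      have hd : dist ((t, y) : ℝ × (EuclideanSpace ℝ (Fin 3))) (t, y') = dist y y' := by
        rw [Prod.dist_eq, dist_self, max_eq_right dist_nonneg]
      simpa [hF, hd] using h
    · -- continuity in time at fixed point
      have hc : ContinuousOn F C := hFC.continuousOn
      have hγ : ContinuousOn (fun t : ℝ => ((t, y) : ℝ × (EuclideanSpace ℝ (Fin 3)))) (Icc 0 ε) :=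
        (continuous_id.prodMk continuous_const).continuousOn
      exact (hc.comp hγ fun t ht => ⟨hsubT ht, hy⟩).congr fun t _ => rfl
    · -- sup bound
      have h := hL₀ (t, y) ⟨hsubT ht, hy⟩
      rw [hLcoe, hLr]
      have h' : ‖u t y‖ ≤ L₀ := by simpa [hF] using h
      exact (h'.trans (le_max_left _ _)).trans (le_add_of_nonneg_right zero_le_one)
    · -- horizon
      show (L : ℝ) * max (ε - (0 : ℝ)) ((0 : ℝ) - 0) ≤ ((1 : ℝ≥0) : ℝ) - ((0 : ℝ≥0) : ℝ)
      rw [hLcoe, sub_zero, sub_zero, max_eq_left hε0.le, NNReal.coe_one, NNReal.coe_zero, sub_zero]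
      exact hεL
  obtain ⟨X, hX0, hX⟩ := hPL.exists_eq_forall_mem_Icc_hasDerivWithinAt₀
  exact ⟨ε, hε0, hεT, X, hX0, hX⟩

/-! ### The material derivative vanishes under (47) -/

/-- Along a Lagrangian path `X` of a jointly smooth `u` on `[0,T]`, the one-sided derivative at `0` of
`t ↦ u(t, X t)` within `[0,ε]` is the material derivative `∂ₜu(0,x) + (u·∇)u(0,x)`, `x = X 0`. -/
theorem hasDerivWithinAt_comp_trajectory {T ε : ℝ} (hT : 0 < T) (hε : 0 < ε) (hεT : ε ≤ T)
    {u : ℝ → (EuclideanSpace ℝ (Fin 3)) → (EuclideanSpace ℝ (Fin 3))} (hu : IsSmoothSpaceTimeOn (Icc 0 T) u) {X : ℝ → (EuclideanSpace ℝ (Fin 3))}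
    (hX : IsTrajectoryOn u (Icc 0 ε) X) :
    HasDerivWithinAt (fun t => u t (X t))
      (timeDerivWithin (Icc 0 T) u 0 (X 0) + convect (u 0) (u 0) (X 0)) (Icc 0 ε) 0 := by
  set F : ℝ × (EuclideanSpace ℝ (Fin 3)) → (EuclideanSpace ℝ (Fin 3)) := uncurry u with hF
  set S : Set (ℝ × (EuclideanSpace ℝ (Fin 3))) := Icc 0 T ×ˢ univ with hS
  have h0T : (0 : ℝ) ∈ Icc 0 T := left_mem_Icc.2 hT.le
  have hmem : ((0 : ℝ), X 0) ∈ S := mk_mem_prod h0T (mem_univ _)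
  have hFd : DifferentiableWithinAt ℝ F S (0, X 0) := (hu (0, X 0) hmem).differentiableWithinAt (by simp)
  set L : ℝ × (EuclideanSpace ℝ (Fin 3)) →L[ℝ] (EuclideanSpace ℝ (Fin 3)) := fderivWithin ℝ F S (0, X 0) with hL
  have hFL : HasFDerivWithinAt F L S (0, X 0) := hFd.hasFDerivWithinAt
  -- (i) the curve `t ↦ (t, X t)`
  have hγ : HasDerivWithinAt (fun t => ((t, X t) : ℝ × (EuclideanSpace ℝ (Fin 3)))) ((1 : ℝ), u 0 (X 0)) (Icc 0 ε) 0 :=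
    (hasDerivWithinAt_id 0 _).prodMk (hX 0 (left_mem_Icc.2 hε.le))
  have hmaps : MapsTo (fun t => ((t, X t) : ℝ × (EuclideanSpace ℝ (Fin 3)))) (Icc 0 ε) S := fun t ht =>
    mk_mem_prod (Icc_subset_Icc_right hεT ht) (mem_univ _)
  have hcomp : HasDerivWithinAt (fun t => u t (X t)) (L ((1 : ℝ), u 0 (X 0))) (Icc 0 ε) 0 := by
    have := hFL.comp_hasDerivWithinAt (0 : ℝ) hγ hmaps
    simpa [hF, Function.comp_def] using this
  -- (ii) `L(1,0) = ∂ₜu(0,x)` (time line) and `L(0,v) = Du(0,x) v` (slice)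
  have htime : timeDerivWithin (Icc 0 T) u 0 (X 0) = L ((1 : ℝ), (0 : (EuclideanSpace ℝ (Fin 3)))) := by
    have hγ₁ : HasDerivWithinAt (fun s : ℝ => ((s, X 0) : ℝ × (EuclideanSpace ℝ (Fin 3)))) ((1 : ℝ), (0 : (EuclideanSpace ℝ (Fin 3)))) (Icc 0 T) 0 :=
      (hasDerivWithinAt_id 0 _).prodMk (hasDerivWithinAt_const _ _ _)
    have hmaps₁ : MapsTo (fun s : ℝ => ((s, X 0) : ℝ × (EuclideanSpace ℝ (Fin 3)))) (Icc 0 T) S := fun s hs =>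
      mk_mem_prod hs (mem_univ _)
    have h := hFL.comp_hasDerivWithinAt (0 : ℝ) hγ₁ hmaps₁
    rw [timeDerivWithin_apply]
    have h' : HasDerivWithinAt (fun s => u s (X 0)) (L ((1 : ℝ), (0 : (EuclideanSpace ℝ (Fin 3))))) (Icc 0 T) 0 := by
      simpa [hF, Function.comp_def] using h
    exact h'.derivWithin (uniqueDiffOn_Icc hT 0 h0T)
  have hslice : ∀ v : (EuclideanSpace ℝ (Fin 3)), fderiv ℝ (u 0) (X 0) v = L ((0 : ℝ), v) := by
    intro v
    have hγ₂ : HasFDerivAt (fun y : (EuclideanSpace ℝ (Fin 3)) => (((0 : ℝ), y) : ℝ × (EuclideanSpace ℝ (Fin 3)))) (ContinuousLinearMap.inr ℝ ℝ (EuclideanSpace ℝ (Fin 3))) (X 0) :=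
      hasFDerivAt_prodMk_right (0 : ℝ) (X 0)
    have hmaps₂ : MapsTo (fun y : (EuclideanSpace ℝ (Fin 3)) => (((0 : ℝ), y) : ℝ × (EuclideanSpace ℝ (Fin 3)))) univ S := fun y _ =>
      mk_mem_prod h0T (mem_univ _)
    have h := hFL.comp (X 0) hγ₂.hasFDerivWithinAt hmaps₂
    have h' : HasFDerivAt (u 0) (L.comp (ContinuousLinearMap.inr ℝ ℝ (EuclideanSpace ℝ (Fin 3)))) (X 0) := by
      have h'' : HasFDerivWithinAt (u 0) (L.comp (ContinuousLinearMap.inr ℝ ℝ (EuclideanSpace ℝ (Fin 3)))) univ (X 0) := by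
        simpa [hF, Function.comp_def] using h
      exact h''.hasFDerivAt_of_univ
    rw [h'.fderiv]
    rfl
  -- (iii) assemble: `L(1, v) = L(1,0) + L(0,v)`
  have hsplit : L ((1 : ℝ), u 0 (X 0)) = L ((1 : ℝ), (0 : (EuclideanSpace ℝ (Fin 3)))) + L ((0 : ℝ), u 0 (X 0)) := by
    rw [← map_add]
    simp
  rw [htime, convect, hslice, ← hsplit]
  exact hcomp

/-- **(47) ⇒ zero material derivative.** If `Step_3` holds, then for every solution of the ansatz class on
`[0,T]` and every point `x`: `∂ₜu(0,x) + (u·∇)u(0,x) = 0` (rigidity `step3R2_rigid` on the sub-slabs `[0,t]`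
along a Picard–Lindelöf path from `x`, then uniqueness of the one-sided derivative). -/
theorem materialDeriv_eq_zero_of_step3 (h3 : Step_3) {ν T : ℝ} (hν : 0 < ν) (hT : 0 < T)
    {u : ℝ → (EuclideanSpace ℝ (Fin 3)) → (EuclideanSpace ℝ (Fin 3))} {p : ℝ → (EuclideanSpace ℝ (Fin 3)) → ℝ} (hsol : IsSolutionOn (Icc 0 T) ν u p) (x : (EuclideanSpace ℝ (Fin 3))) :
    timeDerivWithin (Icc 0 T) u 0 x + convect (u 0) (u 0) x = 0 := by
  have hu : IsSmoothSpaceTimeOn (Icc 0 T) u := hsol.isClassical.smooth_velocity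
  obtain ⟨ε, hε, hεT, X, hX0, hX⟩ := exists_trajectory hT hu x
  -- `t ↦ u(t, X t)` is constant on `[0, ε]`
  have hconst : ∀ t ∈ Icc 0 ε, u t (X t) = u 0 x := by
    intro t ht
    rcases eq_or_lt_of_le ht.1 with h0 | htpos
    · rw [← h0, hX0]
    · have hsub : Icc 0 t ⊆ Icc 0 ε := Icc_subset_Icc_right ht.2
      have hsol' : IsSolutionOn (Icc 0 (0 + t)) ν u p := by
        rw [zero_add]
        exact hsol.mono (hsub.trans (Icc_subset_Icc_right hεT)) (uniqueDiffOn_Icc htpos)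
      have hX' : IsTrajectoryOn u (Icc 0 (0 + t)) X := by
        rw [zero_add]
        exact fun s hs => (hX s (hsub hs)).mono hsub
      have h := step3R2_rigid (step3R2_of_step3 h3) ν hν 0 t le_rfl htpos u p hsol' X hX'
      rw [zero_add, hX0] at h
      exact h
  -- hence its one-sided derivative at `0` vanishes, and it is the material derivative
  have hD := hasDerivWithinAt_comp_trajectory hT hε hεT hu hX
  rw [hX0] at hD
  have hzero : HasDerivWithinAt (fun t => u t (X t)) (0 : (EuclideanSpace ℝ (Fin 3))) (Icc 0 ε) 0 :=
    (hasDerivWithinAt_const (0 : ℝ) (Icc 0 ε) (u 0 x)).congr_of_mem (fun t ht => hconst t ht)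
      (left_mem_Icc.2 hε.le)
  exact (uniqueDiffOn_Icc hε 0 (left_mem_Icc.2 hε.le)).eq_deriv _ hD hzero

/-! ### The negative lemmas -/

/-- **(47) is false on any slab carrying a class solution from a compactly supported non-trivial datum.**
If `Step_3` held, a solution `(u, p)` of the ansatz class on `[0,T]` whose initial slice `u 0` is compactly
supported with non-zero dissipation `Σᵢ∫|∂ᵢu(0)|² > 0` cannot exist: (47) forces `∂ₜu + (u·∇)u ≡ 0` at
`t = 0` (`materialDeriv_eq_zero_of_step3`), so `∇p(0,·) = νΔu(0,·)`; pairing with the divergence-free,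
compactly supported `u 0` gives `0 = ∫⟪∇p(0), u 0⟫ = ν∫⟪Δu(0), u(0)⟫ = −νΣᵢ∫|∂ᵢu(0)|² < 0`. (Hypotheses
form; the named datum `v₀` below is one admissible instance.) [claim: Chadwick2023, status: disputed] -/
theorem Step_3_false_of_classSolution {ν T : ℝ} (hν : 0 < ν) (hT : 0 < T)
    {u : ℝ → (EuclideanSpace ℝ (Fin 3)) → (EuclideanSpace ℝ (Fin 3))} {p : ℝ → (EuclideanSpace ℝ (Fin 3)) → ℝ} (hsol : IsSolutionOn (Icc 0 T) ν u p)
    (hc : HasCompactSupport (u 0))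
    (hD : 0 < ∑ i, ∫ x, ⟪fderiv ℝ (u 0) x (EuclideanSpace.basisFun (Fin 3) ℝ i),
      fderiv ℝ (u 0) x (EuclideanSpace.basisFun (Fin 3) ℝ i)⟫_ℝ) :
    ¬ Literature.Claims.NS.Chadwick2023.Step_3 := by
  intro h3
  have h0T : (0 : ℝ) ∈ Icc 0 T := left_mem_Icc.2 hT.le
  have hu0 : ContDiff ℝ ∞ (u 0) := hsol.isClassical.contDiff_velocity h0T
  -- the momentum equation at `t = 0` with zero material derivative: `∇p(0,x) = νΔu(0,x)`
  have hgrad : ∀ x : (EuclideanSpace ℝ (Fin 3)), gradient (p 0) x = ν • (Δ (u 0)) x := by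
    intro x
    have hm := hsol.isClassical.momentum 0 h0T x
    rw [materialDeriv_eq_zero_of_step3 h3 hν hT hsol x] at hm
    simp only [Pi.zero_apply, add_zero] at hm
    exact (sub_eq_zero.mp hm.symm).symm
  -- `∫⟪∇p(0), u 0⟫ = 0` (pressure against a compactly supported divergence-free field)
  have hp1 : ContDiff ℝ 1 (p 0) := (hsol.isClassical.contDiff_pressure h0T).of_le (by norm_cast)
  have hzero : ∫ x, ⟪gradient (p 0) x, u 0 x⟫_ℝ = 0 := by
    rw [integral_inner_gradient_eq_neg_integral_mul_divergence hp1 (hu0.of_le (by norm_cast)) hc]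
    simp [hsol.isClassical.divFree 0 h0T _]
  -- `ν∫⟪Δu(0), u 0⟫ = −ν Σᵢ∫|∂ᵢu(0)|² < 0` (Green's identity without boundary)
  have hG := integral_inner_laplacian_add_eq_zero (EuclideanSpace.basisFun (Fin 3) ℝ)
    (hu0.of_le (by norm_cast)) (hu0.of_le (by norm_cast)) (Or.inl hc)
  have hneg : ∫ x, ⟪ν • (Δ (u 0)) x, u 0 x⟫_ℝ < 0 := by
    simp_rw [real_inner_smul_left]
    rw [integral_const_mul]
    exact mul_neg_of_pos_of_neg hν (by linarith)
  simp_rw [hgrad] at hzero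
  exact absurd hzero (ne_of_lt hneg)

/-- **`Step_3` (display (47) pp.22–23) is false modulo H(v₀)** — records-grade companion of ADJUDICATED #59
(class «unfilled gap (rigidity-certified)» and locator unchanged). The hypothesis, DISPLAYED INLINE (a named
`def … : Prop` in a Theorems file would be relocated by the gate as a vendored fact), is **H(v₀)**: weighted
short-time classical existence from the one datum `v₀` — for SOME viscosity `ν > 0` and SOME `T > 0` there is a
solution of Chadwick's ansatz class on `[0,T]` (classical Navier–Stokes, `f ≡ 0`, stokeslet decay
`(1+|x|)^{3+n}|Dⁿu(t,x)| ≤ Kₙ(t)` of every slice) with `u 0 = v₀`; in print: weighted-decay local theory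
(Kukavica–Torres, Miyakawa, Brandolese), NOT in the tree and NOT constructed here — the one missing fact of the
UG-AUDIT (refuter-1 g2, 2026-08-27T04:51:44Z). Proof: `Step_3_false_of_classSolution` at `v₀`
(`hasCompactSupport_v₀`, `dissipation_v₀_pos`). [claim: Chadwick2023, status: disputed]
WHAT THIS IS NOT: not a claim about NS regularity or blow-up; not a claim about any author beyond the typed
locator. -/
theorem Step_3_false_of_H
    (hH : ∃ ν : ℝ, 0 < ν ∧ ∃ T : ℝ, 0 < T ∧
      ∃ (u : ℝ → (EuclideanSpace ℝ (Fin 3)) → (EuclideanSpace ℝ (Fin 3))) (p : ℝ → (EuclideanSpace ℝ (Fin 3)) → ℝ),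
        IsSolutionOn (Icc 0 T) ν u p ∧ u 0 = v₀) :
    ¬ Literature.Claims.NS.Chadwick2023.Step_3 := by
  obtain ⟨ν, hν, T, hT, u, p, hsol, hu0⟩ := hH
  refine Step_3_false_of_classSolution hν hT hsol ?_ ?_
  · rw [hu0]; exact hasCompactSupport_v₀
  · rw [hu0]; exact dissipation_v₀_pos

end Summit.NavierStokesRegularity.NavierStokesRegularity.Theorems.Chadwick2023
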